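import Mathlib
import HarnessLib
import HarnessLib.Audit
import Summits.MatrixMultiplication.Statement
import Literature.Computability.AlgebraicComplexity.AsymptoticSpectrum
import Literature.Computability.AlgebraicComplexity.QuantumFunctionalsUpper
import Literature.Computability.AlgebraicComplexity.QuantumFunctionalPoint
import Literature.Computability.AlgebraicComplexity.AsymptoticSpectrumDuality
import HarnessLib.Audit.Status.Attr

/-!
Route: IsotypicSaturation

# Route IsotypicSaturation — spectral points factor monotonically through moment polytopes;
maximality of Δ(⟨4⟩) then gives ω = 2

X = POLYTOPE SATURATION (card isotypic-saturation-dark-spectral-points, horn S made precise): every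
universal spectral point F
of complex 3-tensors (tree: `IsUniversalSpectralPoint ℂ F`) is MONOTONE UNDER INCLUSION OF MOMENT
POLYTOPES — if every triple of
partitions λ = (λ¹,λ²,λ³) ⊢ n occurring in a tensor power of s (the isotypic character sums
`isotypicSum₁/₂/₃` do not kill
`kroneckerPow s n`; this is Bürgisser–Ikenmeyer's semigroup of representations S(s) of the orbit
closure cl(GL³·s)) has a multiple
k·λ occurring in a power of t (⟺ Δ(s) ⊆ Δ(t), Δ = moment polytope = closure of normalised S), then F
s ≤ F t. A "dark" point
(F(⟨2,2,2⟩) > 4, i.e. ω > 2) must therefore read UNSATURATED isotypic data (holes/multiplicities of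
S(t)), which is horn U.
It suffices because Δ(⟨4⟩) is the whole Kronecker polytope of format 4×4×4 (arXiv:2503.22633), so
Δ(⟨2,2,2⟩) ⊆ Δ(⟨4⟩) and
X forces F(⟨2,2,2⟩) ≤ F(⟨4⟩) = 4 for all F, i.e. R̃(⟨2,2,2⟩) = 4 = 2^ω by Strassen duality (proved
in tree).
Lean: `∀ F : Literature.Computability.AlgebraicComplexity.SpectralMap ℂ,
Literature.Computability.AlgebraicComplexity.IsUniversalSpectralPoint ℂ F → ∀ {ι κ μ ι' κ' μ' :
Type} [Fintype ι] [Fintype κ] [Fintype μ] [Fintype ι'] [Fintype κ'] [Fintype μ'] (s : ι → κ → μ → ℂ)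
(t : ι' → κ' → μ' → ℂ), (∀ (n : ℕ) (lam : Fin 3 → Nat.Partition n), 0 < n →
Literature.Computability.AlgebraicComplexity.isotypicSum₁ (lam 0)
(Literature.Computability.AlgebraicComplexity.isotypicSum₂ (lam 1)
(Literature.Computability.AlgebraicComplexity.isotypicSum₃ (lam 2)
(Literature.Computability.AlgebraicComplexity.kroneckerPow s n))) ≠ 0 → ∃ (k : ℕ) (mu : Fin 3 →
Nat.Partition (k * n)), 0 < k ∧ (∀ j, (mu j).parts = (lam j).parts.map (fun p => k * p)) ∧
Literature.Computability.AlgebraicComplexity.isotypicSum₁ (mu 0)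
(Literature.Computability.AlgebraicComplexity.isotypicSum₂ (mu 1)
(Literature.Computability.AlgebraicComplexity.isotypicSum₃ (mu 2)
(Literature.Computability.AlgebraicComplexity.kroneckerPow t (k * n)))) ≠ 0) → F s ≤ F t`

## Assembly
Instantiate PolytopeSaturation at s = ⟨2,2,2⟩ = `matMulTensor ℂ 2 2 2` (format (Fin 2 × Fin 2)³, all
cardinalities 4) and t = ⟨4⟩ =
`unitTensor ℂ 4`; the domination hypothesis is UnitTensorPolytopeMaximal at s (checked to typecheck
in Sketch.lean). Hence
F(⟨2,2,2⟩) ≤ F(⟨4⟩) = 4 for every universal spectral point F (additivity + normalisation, ⟨4⟩ ~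
⟨1⟩^{⊕4}); Strassen duality
(PROVED: `strassen_duality_asymptoticRank_holds`) gives R̃(⟨2,2,2⟩) ≤ 4;
`asymptoticRank_matMulTensor` (PROVED) gives
2^ω = R̃(⟨2,2,2⟩) ≤ 4, so ω ≤ 2, and `two_le_omega` (Theorems/AsymptoticSpectrumOmegaGeTwo) closes
ω(ℂ) = 2. Pure glue over
proved facts; no unproved named fact is imported.

Rationale: WHY THIS LINE. Every universal spectral point has GL³-stable Zariski-closed sublevel sets
(arXiv:2411.15789), whose ideals are sums of isotypic
components; the quantum functionals F^θ (ChristandlVranaZuiddam2023 Def. 3.3/Thm. 3.30, CVZ Cor.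
3.31 PROVED in tree) read only
OCCURRENCE of isotypic types, i.e. the moment polytope Δ(t) = normalised closure of
BurgisserIkenmeyer2011's semigroup S(t) (Def. 3.1,
Def. 8.1). The card's dichotomy "saturated (polytope) data vs multiplicity data", transplanted from
GCT's occurrence-vs-multiplicity
story (BurgisserIkenmeyerPanovaJAMS2019), becomes one falsifiable statement X strictly between
Strassen's asymptotic rank conjecture
(formats ≤ 4) and CVZ universality; the new ingredient that makes it USEFUL is the 2025 computation
Δ(⟨4⟩) = Kron(4,4,4)
(vandenBergChristandlLysikovNieuwboerWalterZuiddam2025 §1,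
vandenBergEtAl2025ComputingMomentPolytopes §6.5): with it X alone gives
ω = 2, no classification of Δ(ℂ) needed — whereas the finer SEMIGROUP version of saturation provably
cannot take this shortcut
(BurgisserIkenmeyer2011 Lemma 6.1: S(⟨2,2,2⟩) ⊄ S(⟨5⟩), an occurrence obstruction in degree 8).
Imported areas: geometric invariant
theory / moment polytopes (Ness–Mumford, Brion, Franz, Vergne–Walter), representation theory of S_n
× GL (Schur–Weyl, Kronecker
coefficients), quantum marginal problem; versus route AsymptoticSpectrum (items 0582/0583:
universality stated informally, no
mechanism) this route names the mechanism, types it over existing declarations, and isolates the one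
polytope fact that turns it into ω = 2.

RANKED CRUXES. #2 PolytopeSaturation (crux) — every universal spectral point of complex 3-tensors is
monotone under moment-polytope inclusion: if every partition triple occurring (via the three
isotypic character sums) in some power s^{⊗n} has a multiple k·λ occurring in t^{⊗kn}, then F s ≤ F
t (card horn S, "saturation theorem", in its polytope form; implies F constant on tensors with equal
moment polytope). [difficulty: open-problem] (why it might fail: It forces R̃(t) ≤ 4 for every t ∈
ℂ⁴⊗ℂ⁴⊗ℂ⁴ and ω = 2; a dark point reading holes/multiplicities of S(t) (BI2011 §3.1, Thm 7.1
non-normality) rather than Δ(t) breaks it, and Δ itself is NOT monotone under asymptotic restriction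
(arXiv:2503.22633 Thm 1.9).) [ChristandlVranaZuiddam2023, BurgisserIkenmeyer2011, arXiv:2503.22633,
arXiv:2411.15789, Strassen1988]
#3 UnitTensorPolytopeMaximal (crux) — the moment polytope of the unit tensor ⟨4⟩ is maximal among
tensors with all three dimensions ≤ 4 (Δ(⟨4⟩) = Kron(4,4,4), Bürgisser–Ikenmeyer Problem 8.3 for m =
4): every partition triple occurring in a power of such a tensor s has a multiple occurring in a
power of ⟨4⟩; instantiated at s = ⟨2,2,2⟩ ∈ (ℂ^{2×2})^{⊗3} it is the glue of the assembly.
[difficulty: L] (why it might fail: Δ(⟨4⟩) = Kron₄₄₄ is asserted (arXiv:2503.22633 §1;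
arXiv:2510.08336 §6.5) from rounded tensor-scaling certificates at the Vergne–Walter vertex list; a
missed vertex or rounding slip breaks it, and the unscaled semigroup version is FALSE (BI2011 Lemma
6.1: S(⟨2,2,2⟩) ⊄ S(⟨5⟩)).) [arXiv:2503.22633, arXiv:2510.08336, BurgisserIkenmeyer2011,
BurgisserChristandlIkenmeyer2011]
#4 SaturatedPointsAreQuantum (crux) — rigidity / universality for saturated points: a universal
spectral point that is monotone under moment-polytope inclusion equals a quantum functional F^θ
(tree: `quantumFunctionalPoint θ`) for some θ in the probability simplex on Fin 3 (card support (i)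
"saturated ⟺ quantum", the converse direction being QuantumFunctionalsSaturated). [deps:
PolytopeSaturation] [difficulty: XL] (why it might fail: a monotone, ⊕-additive, ⊗-multiplicative
valuation on moment polytopes need not be an entropy maximum: t ↦ max over Δ(t) of 2^φ for other
concave φ (Rényi-type families, Vrana2023 = arXiv:2008.11108) are candidates and no classification
of such valuations exists (CVZ2023 §1 asks it).) [ChristandlVranaZuiddam2023, Vrana2023,
JensenVrana2020, arXiv:2601.21553]
#5 DarkPolytopePoint (crux) — NEGATIVE HORN (card U1): there is a universal spectral point that is
not monotone under moment-polytope inclusion — a "dark", multiplicity-sensitive point; the card's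
candidate mechanism is a relative-multiplicity pressure functional P_{θ,β}(t) = lim (1/n) log Σ_λ
relmult_λ(t,n)^β 2^{n⟨θ,H(λ̄)⟩} normalised against the secant variety (definitions requested), to be
tested first on W, where R̃(W) = 2 is known. [difficulty: open-problem] (why it might fail:
universality may simply hold; every finite-temperature functional known (Vrana2023, JensenVrana2020)
loses ⊗-multiplicativity or degeneration-monotonicity, the naive (non-relative) multiplicity count
already fails P(⟨r⟩) = r, and multiplicities of cl(GL³·⟨2,2,2⟩^{⊗n}) are as hard as GCT found them.)
[Vrana2023, JensenVrana2020, BurgisserIkenmeyer2011, BurgisserIkenmeyerPanovaJAMS2019]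
#9 QuantumFunctionalsSaturated (support) — consistency / converse of SaturatedPointsAreQuantum:
every quantum functional F^θ (θ in the simplex) is monotone under moment-polytope inclusion — from
E_θ = E^θ (CVZ Thm. 3.30, proved in tree) as a supremum over admissible = occurring tuples,
H(k·λ/(kn)) = H(λ/n), and the completeness relation Σ_λ P_λ = id for partially supported θ.
[difficulty: provable-now] [ChristandlVranaZuiddam2023]

TWO-LAYER PLAN. PolytopeSaturation ⇐ IsotypicCompression (F(s)^n ≤ 2^{o(n)} · max over λ ∈ S(s)_n of
an isotypic value F̂(λ), from
s^{⊗n} = Σ_λ P_λ s^{⊗n}, ≤ poly(n) summands, F subadditive under +) → IsotypicExtraction (λ ∈ S(t)_n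
⇒ F(t)^n ≥ 2^{-o(n)} F̂(λ))
→ PolytopeSaturation (k = 2). UnitTensorPolytopeMaximal ⇐ KroneckerConeGenerators (a finite list v_i
with g ≠ 0 generating the
format-4 Kronecker cone: Vergne–Walter) → UnitTensorHitsGenerators (a multiple of each v_i occurs in
a power of ⟨4⟩: explicit
highest-weight-vector evaluations / rounded scaling certificates) → UnitTensorPolytopeMaximal.
SaturatedPointsAreQuantum ⇐
VertexReduction (a polytope-monotone F is t ↦ max over Δ(t) of a point functional φ_F) →
EntropyRigidity (⊕/⊗ force φ_F = 2^{θ·H}).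

KILL CRITERIA. DarkPolytopePoint proved (= PolytopeSaturation refuted) closes the route
`refuted:PolytopeSaturation` UNLESS the witness pair lives in
formats > 4 only — then pivot (restate) to saturation against unit tensors of format ≤ 4, which
still gives ω = 2. A point of
Kron(4,4,4) outside Δ(⟨4⟩) refutes UnitTensorPolytopeMaximal: restate to the ⟨2,2,2⟩-specific
domination Δ(⟨2,2,2⟩) ⊆ Δ(⟨4⟩).
SaturatedPointsAreQuantum refuted alone does not close the route (drop it; the assembly does not use
it). Any universal spectral point
with F(⟨2,2,2⟩) > 4 (route BorderRankLowerBound / AsymptoticSpectrum kill criterion) refutes ω = 2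
and this route with it.
Universality (AsymptoticSpectrum 0582) proved elsewhere moots PolytopeSaturation (it follows via
QuantumFunctionalsSaturated).

NOT DECOMPOSED YET. The dictionary occurrence ↔ moment map (Ness–Mumford, Brion, Franz) is
deliberately avoided: every item is stated representation-
theoretically, so no symplectic geometry is load-bearing. Not filed: the Vergne–Walter inequality
list for Kron(4,4,4) (layer-2 child
of UnitTensorPolytopeMaximal); formats m ≥ 5 (Δ(⟨m⟩) maximal is open there and irrelevant for
⟨2,2,2⟩); the pressure functional's
definitions (relative isotypic multiplicity, P_{θ,β}) — requested as definitions, the W-consistency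
test rides with DarkPolytopePoint;
the semigroup (unscaled) saturation statement — dead on arrival for the assembly by BI2011 Lemma 6.1
and not filed.

CHEAPEST FALSIFIER. A LOOKUP: arXiv:2510.08336 Tables 333/444 list all moment polytopes of ℂ³⊗ℂ³⊗ℂ³
(28 polytopes, all inclusions) and several of
ℂ⁴⊗ℂ⁴⊗ℂ⁴; one inclusion Δ(s) ⊆ Δ(t) together with a KNOWN strict inequality Q̃(s) > Q̃(t) or R̃(s) >
R̃(t) (values in
ChristandlVranaZuiddam2023 §4–5, Strassen1991) refutes PolytopeSaturation at once. Pairs I checked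
by hand: W ⊂ ⟨2⟩ (Q̃ 1.89 < 2,
R̃ 2 = 2: consistent), ⟨2,2,2⟩ ⊂ ⟨4⟩ (consistent iff ω = 2), equal maximal polytopes ⟨m⟩ ~ generic
(consistent iff asymptotic rank
conjecture in format m ≤ 4): no refutation found; no tensor with R̃ above its maximal flattening
rank is known.

NUMBERS. R̲(⟨2,2,2⟩) = 7, Q̃(⟨2,2,2⟩) = 4, R̃(⟨2,2,2⟩) = 2^ω ∈ [4, 2^2.3714]; F^θ(⟨2,2,2⟩) = 4 for
all θ (uniform point u₄ ∈ Δ, BI2011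
Lemma 8.2). Δ(⟨m⟩) = Kron(m,m,m) for m ∈ {2,3,4} (arXiv:2503.22633 §1), open for m ≥ 5; p₄ =
((½,½,0,0),(⅓,⅓,⅓,0),(¼,¼,¼,¼)) ∈
Kron₄₄₄ \ Δ(⟨2,2,2⟩) (ibid. Thm 1.4). Occurrence obstruction λ₂ = ((2,2,2,2),(2,2,2,2),(5,1,1,1)) ∈
S(⟨2,2,2⟩) \ S(⟨5⟩) in degree 8
(BurgisserIkenmeyer2011 Lemma 6.1), so λ₂ has a multiple in S(⟨4⟩) only for k ≥ 2. Items at open: 6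
(4 cruxes, 1 support, 1 assembly).

DEFINITION REQUESTS. D1 `isotypicMultiplicity t n lam`
(Literature/Computability/AlgebraicComplexity): the multiplicity of the GL³-type λ in the cyclic
GL³-module generated by `kroneckerPow t n` (= rank of P_λ t^{⊗n} across the Schur–Weyl cut S_λ ⊗
([λ¹]⊗[λ²]⊗[λ³])^{S_n};
= multiplicity of V_λ* in O(cl(GL³·t))_n, BurgisserIkenmeyer2011 §3.1), 1 ≤ · ≤ g(λ) when λ occurs.
D2 `pressureFunctional θ β t`
(Summits/MatrixMultiplication/MatrixMultiplication/Theorems, new object): lim sup (1/n) log₂ Σ_λ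
(isotypicMultiplicity t n λ /
isotypicMultiplicity (generic of the secant variety σ_{R(t)}) n λ)^β 2^{n θ·H(λ̄)}. Cite request:
fact "Δ(⟨4⟩) = Kron(4,4,4)"
(arXiv:2503.22633 §1 / arXiv:2510.08336 §6.5) as a named Literature fact. All filed right after
open, `--for` DarkPolytopePoint.

Novelty: Searches (2026-08-15): `lit frontier MatrixMultiplication --since 2021` (30 rows; relevant
arXiv:2601.21553, arXiv:2604.18283,
doi:10.1090/bull/1880); `lit search --source zbmath "moment polytope unit tensor"` (5; found
arXiv:2503.22633), `"Computing moment
polytopes of tensors"` (4; found arXiv:2510.08336), `"universal spectral points asymptotic spectrum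
tensors quantum functionals"` (1:
CVZ), `"asymptotic tensor rank Zariski closed sublevel"` (1: arXiv:2411.15789), `"Vrana family of
multipartite entanglement measures"`
(1); `lit galaxy search "asymptotic spectrum of tensors" --star all` (10, noise + BFGOWW tensor
scaling + ITCS 2024 discreteness),
`"universal spectral points" --star all` (0); `lit read arxiv:1011.1350` (pp. 1–10),
`arxiv:2503.22633` (pp. 1–7),
`arxiv:2510.08336` (§6); OpenAlex / S2 / arXiv API rate-limited (429) this session, local searchd
reset — recorded in NOTES.md.
Nearest prior art found: ChristandlVranaZuiddam2023 (universality question; F^θ = entropy max over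
Δ); BurgisserIkenmeyer2011
(semigroup S(w), moment-polytope coarsening, Problem 8.3, Lemma 6.1 obstruction); arXiv:2503.22633
(Δ(⟨4⟩) maximal, Δ(⟨2,2,2⟩)
not, Δ not ≲-monotone; asks whether quantum functionals "pick out only special information from
Δ(T)").
Delta: none of these states the intermediate conjecture "every spectral point factors monotonically
through Δ" nor notices that, with
Δ(⟨4⟩) = Kron(4,4,4) now computed, it ALONE yields ω = 2 while its semigroup refinement provably
cannot (BI  [refs: 10.1090/bull/1880, 2601.21553, 2604.18283, 2503.22633, 2510.08336, 2411.15789, 1011.1350, doi:10.1090/bull/1880, arxiv:1011.1350, arxiv:2503.22633, arxiv:2510.08336, ChristandlVranaZuiddam2023, BurgisserIkenmeyer2011]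

Barriers (technique_class: asymptotic-spectrum, moment-polytope, universality): - technique_class: asymptotic-spectrum, moment-polytope, universality
- Literature.Barriers.MatrixMultiplication.IrreversibilityBarrier: not in class — no intermediate
tensor is powered and restricted; ⟨4⟩ enters only as a comparison point of Δ(ℂ) (F(⟨4⟩) = 4 by the
axioms), and the certificate R̃(⟨2,2,2⟩) = 4 comes from duality over ALL spectral points (CVZ2021
evasion "no fixed intermediate tensor").
- Literature.Barriers.MatrixMultiplication.UniversalMethodBarrier: same — no degeneration of powers
of a fixed CW-type tensor is used; Alman's ω_u bounds constrain methods, not spectral points.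
- Literature.Barriers.MatrixMultiplication.UnstableTensorBarrier: n/a — both tensors compared
(⟨2,2,2⟩, ⟨4⟩) are semistable with the uniform point in their polytopes; nothing is extracted from
an unstable tensor.
- Literature.Barriers.MatrixMultiplication.LinearRankMethodBarrier: bears on the negative horn only:
a dark spectral point would certify ω > 2 through multiplicities in coordinate rings of orbit
closures, not through a matrix of linear forms, so the 6m−4 cactus cap does not apply; conceded that
no such point is known.
- Literature.Barriers.MatrixMultiplication.InfimumNotMinimumBarrier: respected — every statement is
asymptotic (R̃, Δ, spectral points); no finite algorithm or exact rank is claimed.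
- Negatives index: empty for MatrixMultiplication at filing (ledger negatives: 0 refuted
statements).

Novelty grade: new-combination — refuter route-review 2026-08-15. NOVELTY new-combination (own reading of arXiv:2503.22633 pp3–7,14 + arXiv:2510.08336 §6.5 + tree; lit search degraded this session: searchd reset/S2 429/arXiv 0): idea 1 'X = quantum functionals ⇒ ω=2' (printed, vdB+25 p7; CVZ18 question) + idea 2 'Δ(⟨4⟩)=Kron444' (v (refuter refuter-rreview-route-AtomisticToContinu-e5aa7b40-g2-0, 2026-08-15T14:29:28Z; prior: arxiv:1709.07851,arxiv:2503.22633,arxiv:2510.08336,arxiv:1011.1350)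

History (route lifecycle, newest last):
- 2026-08-22T08:37:02Z · DORMANT — reconciler: no traction for 5.2 d (last activity item-evidence-added at 2026-08-17T03:02:17Z); parked, not closed — `ledger route dormant route-MatrixMultiplica (operator:999:1573011)
- 2026-08-31T13:09:25Z · REACTIVATED (open) — reconciler: reactivated — activity item-proof-filed at 2026-08-31T11:50:35Z after parking at 2026-08-22T08:37:02Z (operator:999:2589566)

sub-problem: MatrixMultiplication · status: open · opened planner-plancard-MatrixMultiplication-MatrixM-999ac3ee-0 2026-08-15T11:33:32Z · rev 1 · ledger route-MatrixMultiplication-IsotypicSaturation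
GENERATED by the gate from the ledger (D-0016/17). Provers cite these decls: `theorem foo : Summit.MatrixMultiplication.MatrixMultiplication.Theses.IsotypicSaturation.<Decl> := …` in Summits/MatrixMultiplication/MatrixMultiplication/Theorems/<Name>.lean.
-/

namespace Summit.MatrixMultiplication.MatrixMultiplication.Theses.IsotypicSaturation

open scoped BigOperators Topology Manifold Classical MeasureTheory ProbabilityTheory Matrix InnerProductSpace ComplexConjugate ContinuousMap
open Filter Set Function TopologicalSpace MeasureTheory

attribute [summit_statement] _root_.MatrixMultiplication

/-- item stmt-MatrixMultiplication-4417 · crux · rank 2 · open · by planner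
why it might fail: It forces R̃(t) ≤ 4 for every t ∈ ℂ⁴⊗ℂ⁴⊗ℂ⁴ and ω = 2; a dark point reading holes/multiplicities of S(t) (BI2011 §3.1, Thm 7.1 non-normality) rather than Δ(t) breaks it, and Δ itself is NOT monotone under asymptotic restriction (arXiv:2503.22633 Thm 1.9).
sources: ChristandlVranaZuiddam2023, BurgisserIkenmeyer2011, arXiv:2503.22633, arXiv:2411.15789, Strassen1988
[crux] every universal spectral point of complex 3-tensors is monotone under moment-polytope
inclusion: if every partition triple occurring (via the three isotypic character sums) in some power
s^{⊗n} has a multiple k·λ occurring in t^{⊗kn}, then F s ≤ F t (card horn S, "saturation theorem",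
in its polytope form; implies F constant on tensors with equal moment polytope). [difficulty:
open-problem] -/
@[route_item "route-MatrixMultiplication-IsotypicSaturation", crux]
def PolytopeSaturation : Prop :=
  ∀ F : Literature.Computability.AlgebraicComplexity.SpectralMap ℂ, Literature.Computability.AlgebraicComplexity.IsUniversalSpectralPoint ℂ F → ∀ {ι κ μ ι' κ' μ' : Type} [Fintype ι] [Fintype κ] [Fintype μ] [Fintype ι'] [Fintype κ'] [Fintype μ'] (s : ι → κ → μ → ℂ) (t : ι' → κ' → μ' → ℂ), (∀ (n : ℕ) (lam : Fin 3 → Nat.Partition n), 0 < n → Literature.Computability.AlgebraicComplexity.isotypicSum₁ (lam 0) (Literature.Computability.AlgebraicComplexity.isotypicSum₂ (lam 1) (Literature.Computability.AlgebraicComplexity.isotypicSum₃ (lam 2) (Literature.Computability.AlgebraicComplexity.kroneckerPow s n))) ≠ 0 → ∃ (k : ℕ) (mu : Fin 3 → Nat.Partition (k * n)), 0 < k ∧ (∀ j, (mu j).parts = (lam j).parts.map (fun p => k * p)) ∧ Literature.Computability.AlgebraicComplexity.isotypicSum₁ (mu 0) (Literature.Computability.AlgebraicComplexity.isotypicSum₂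 (mu 1) (Literature.Computability.AlgebraicComplexity.isotypicSum₃ (mu 2) (Literature.Computability.AlgebraicComplexity.kroneckerPow t (k * n)))) ≠ 0) → F s ≤ F t

/-- item stmt-MatrixMultiplication-4418 · crux · rank 3 · closed · proved by Summit.MatrixMultiplication.MatrixMultiplication.Theorems.unitTensorPolytopeMaximal_holds (planner) · by planner
why it might fail: Δ(⟨4⟩) = Kron₄₄₄ is asserted (arXiv:2503.22633 §1; arXiv:2510.08336 §6.5) from rounded tensor-scaling certificates at the Vergne–Walter vertex list; a missed vertex or rounding slip breaks it, and the unscaled semigroup version is FALSE (BI2011 Lemma 6.1: S(⟨2,2,2⟩) ⊄ S(⟨5⟩)).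
sources: arXiv:2503.22633, arXiv:2510.08336, BurgisserIkenmeyer2011, BurgisserChristandlIkenmeyer2011
[crux] the moment polytope of the unit tensor ⟨4⟩ is maximal among tensors with all three dimensions
≤ 4 (Δ(⟨4⟩) = Kron(4,4,4), Bürgisser–Ikenmeyer Problem 8.3 for m = 4): every partition triple
occurring in a power of such a tensor s has a multiple occurring in a power of ⟨4⟩; instantiated at
s = ⟨2,2,2⟩ ∈ (ℂ^{2×2})^{⊗3} it is the glue of the assembly. [difficulty: L] -/
@[route_item "route-MatrixMultiplication-IsotypicSaturation", crux]
def UnitTensorPolytopeMaximal : Prop :=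
  ∀ {ι κ μ : Type} [Fintype ι] [Fintype κ] [Fintype μ], Fintype.card ι ≤ 4 → Fintype.card κ ≤ 4 → Fintype.card μ ≤ 4 → ∀ (s : ι → κ → μ → ℂ) (n : ℕ) (lam : Fin 3 → Nat.Partition n), 0 < n → Literature.Computability.AlgebraicComplexity.isotypicSum₁ (lam 0) (Literature.Computability.AlgebraicComplexity.isotypicSum₂ (lam 1) (Literature.Computability.AlgebraicComplexity.isotypicSum₃ (lam 2) (Literature.Computability.AlgebraicComplexity.kroneckerPow s n))) ≠ 0 → ∃ (k : ℕ) (mu : Fin 3 → Nat.Partition (k * n)), 0 < k ∧ (∀ j, (mu j).parts = (lam j).parts.map (fun p => k * p)) ∧ Literature.Computability.AlgebraicComplexity.isotypicSum₁ (mu 0) (Literature.Computability.AlgebraicComplexity.isotypicSum₂ (mu 1) (Literature.Computability.AlgebraicComplexity.isotypicSum₃ (mu 2) (Literature.Computability.AlgebraicComplexity.kroneckerPow (Literature.Computability.AlgebraicComplexity.unitTensor ℂ 4) (k * n)))) ≠ 0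

-- `UnitTensorPolytopeMaximal` holds: proved by `Summit.MatrixMultiplication.MatrixMultiplication.Theorems.unitTensorPolytopeMaximal_holds` (its module imports this route file, so no `_holds` link can be stated here).

/-- item stmt-MatrixMultiplication-4419 · crux · rank 4 · open · by planner
why it might fail: a monotone, ⊕-additive, ⊗-multiplicative valuation on moment polytopes need not be an entropy maximum: t ↦ max over Δ(t) of 2^φ for other concave φ (Rényi-type families, Vrana2023 = arXiv:2008.11108) are candidates and no classification of such valuations exists (CVZ2023 §1 asks it).
sources: ChristandlVranaZuiddam2023, Vrana2023, JensenVrana2020, arXiv:2601.21553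
[crux] rigidity / universality for saturated points: a universal spectral point that is monotone
under moment-polytope inclusion equals a quantum functional F^θ (tree: `quantumFunctionalPoint θ`)
for some θ in the probability simplex on Fin 3 (card support (i) "saturated ⟺ quantum", the converse
direction being QuantumFunctionalsSaturated). [deps: PolytopeSaturation] [difficulty: XL] -/
@[route_item "route-MatrixMultiplication-IsotypicSaturation"]
def SaturatedPointsAreQuantum : Prop :=
  ∀ F : Literature.Computability.AlgebraicComplexity.SpectralMap ℂ, Literature.Computability.AlgebraicComplexity.IsUniversalSpectralPoint ℂ F → (∀ {ι κ μ ι' κ' μ' : Type} [Fintype ι] [Fintype κ] [Fintype μ] [Fintype ι'] [Fintype κ'] [Fintype μ'] (s : ι → κ → μ → ℂ) (t : ι' → κ' → μ' → ℂ), (∀ (n : ℕ) (lam : Fin 3 → Nat.Partition n), 0 < n → Literature.Computability.AlgebraicComplexity.isotypicSum₁ (lam 0) (Literature.Computability.AlgebraicComplexity.isotypicSum₂ (lam 1) (Literature.Computability.AlgebraicComplexity.isotypicSum₃ (lam 2) (Literature.Computability.AlgebraicComplexity.kroneckerPow s n))) ≠ 0 → ∃ (k : ℕ) (mu : Fin 3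 → Nat.Partition (k * n)), 0 < k ∧ (∀ j, (mu j).parts = (lam j).parts.map (fun p => k * p)) ∧ Literature.Computability.AlgebraicComplexity.isotypicSum₁ (mu 0) (Literature.Computability.AlgebraicComplexity.isotypicSum₂ (mu 1) (Literature.Computability.AlgebraicComplexity.isotypicSum₃ (mu 2) (Literature.Computability.AlgebraicComplexity.kroneckerPow t (k * n)))) ≠ 0) → F s ≤ F t) → ∃ θ : Fin 3 → ℝ, θ ∈ stdSimplex ℝ (Fin 3) ∧ ∀ {ι κ μ : Type} [Fintype ι] [Fintype κ] [Fintype μ] (t : ι → κ → μ → ℂ), F t = Literature.Computability.AlgebraicComplexity.quantumFunctionalPoint θ t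

/-- item stmt-MatrixMultiplication-4420 · crux · rank 5 · open · by planner
why it might fail: universality may simply hold; every finite-temperature functional known (Vrana2023, JensenVrana2020) loses ⊗-multiplicativity or degeneration-monotonicity, the naive (non-relative) multiplicity count already fails P(⟨r⟩) = r, and multiplicities of cl(GL³·⟨2,2,2⟩^{⊗n}) are as hard as GCT found them.
sources: Vrana2023, JensenVrana2020, BurgisserIkenmeyer2011, BurgisserIkenmeyerPanovaJAMS2019
[crux] NEGATIVE HORN (card U1): there is a universal spectral point that is not monotone under
moment-polytope inclusion — a "dark", multiplicity-sensitive point; the card's candidate mechanism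
is a relative-multiplicity pressure functional P_{θ,β}(t) = lim (1/n) log Σ_λ relmult_λ(t,n)^β
2^{n⟨θ,H(λ̄)⟩} normalised against the secant variety (definitions requested), to be tested first on
W, where R̃(W) = 2 is known. [difficulty: open-problem] -/
@[route_item "route-MatrixMultiplication-IsotypicSaturation"]
def DarkPolytopePoint : Prop :=
  ∃ F : Literature.Computability.AlgebraicComplexity.SpectralMap ℂ, Literature.Computability.AlgebraicComplexity.IsUniversalSpectralPoint ℂ F ∧ ∃ (ι κ μ ι' κ' μ' : Type) (_ : Fintype ι) (_ : Fintype κ) (_ : Fintype μ) (_ : Fintype ι') (_ : Fintype κ') (_ : Fintype μ') (s : ι → κ → μ → ℂ) (t : ι' → κ' → μ' → ℂ), (∀ (n : ℕ) (lam : Fin 3 → Nat.Partition n), 0 < n → Literature.Computability.AlgebraicComplexity.isotypicSum₁ (lam 0) (Literature.Computability.AlgebraicComplexity.isotypicSum₂ (lam 1) (Literature.Computability.AlgebraicComplexity.isotypicSum₃ (lam 2) (Literature.Computability.AlgebraicComplexity.kroneckerPow s n))) ≠ 0 → ∃ (k : ℕ) (mu : Fin 3 → Nat.Partition (k * n)),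 0 < k ∧ (∀ j, (mu j).parts = (lam j).parts.map (fun p => k * p)) ∧ Literature.Computability.AlgebraicComplexity.isotypicSum₁ (mu 0) (Literature.Computability.AlgebraicComplexity.isotypicSum₂ (mu 1) (Literature.Computability.AlgebraicComplexity.isotypicSum₃ (mu 2) (Literature.Computability.AlgebraicComplexity.kroneckerPow t (k * n)))) ≠ 0) ∧ F t < F s

/-- item stmt-MatrixMultiplication-4421 · support · rank 9 · closed · proved by Summit.MatrixMultiplication.MatrixMultiplication.Theorems.quantumFunctionalsSaturated_proof @ eac1817e3e66 (prover) · by planner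
sources: ChristandlVranaZuiddam2023
[support] consistency / converse of SaturatedPointsAreQuantum: every quantum functional F^θ (θ in
the simplex) is monotone under moment-polytope inclusion — from E_θ = E^θ (CVZ Thm. 3.30, proved in
tree) as a supremum over admissible = occurring tuples, H(k·λ/(kn)) = H(λ/n), and the completeness
relation Σ_λ P_λ = id for partially supported θ. [difficulty: provable-now] -/
@[route_item "route-MatrixMultiplication-IsotypicSaturation"]
def QuantumFunctionalsSaturated : Prop :=
  ∀ θ : Fin 3 → ℝ, θ ∈ stdSimplex ℝ (Fin 3) → ∀ {ι κ μ ι' κ' μ' : Type} [Fintype ι] [Fintype κ] [Fintype μ] [Fintype ι'] [Fintype κ'] [Fintype μ'] (s : ι → κ → μ → ℂ) (t : ι' → κ' → μ' → ℂ), (∀ (n : ℕ) (lam : Fin 3 → Nat.Partition n), 0 < n → Literature.Computability.AlgebraicComplexity.isotypicSum₁ (lam 0) (Literature.Computability.AlgebraicComplexity.isotypicSum₂ (lam 1) (Literature.Computability.AlgebraicComplexity.isotypicSum₃ (lam 2) (Literature.Computability.AlgebraicComplexity.kroneckerPow s n))) ≠ 0 → ∃ (k : ℕ) (mu : Fin 3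 → Nat.Partition (k * n)), 0 < k ∧ (∀ j, (mu j).parts = (lam j).parts.map (fun p => k * p)) ∧ Literature.Computability.AlgebraicComplexity.isotypicSum₁ (mu 0) (Literature.Computability.AlgebraicComplexity.isotypicSum₂ (mu 1) (Literature.Computability.AlgebraicComplexity.isotypicSum₃ (mu 2) (Literature.Computability.AlgebraicComplexity.kroneckerPow t (k * n)))) ≠ 0) → Literature.Computability.AlgebraicComplexity.quantumFunctionalPoint θ s ≤ Literature.Computability.AlgebraicComplexity.quantumFunctionalPoint θ t

-- `QuantumFunctionalsSaturated` holds: proved by `Summit.MatrixMultiplication.MatrixMultiplication.Theorems.quantumFunctionalsSaturated_proof` @ eac1817e3e66 (its module imports this route file, so no `_holds` link can be stated here).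

/-- item stmt-MatrixMultiplication-4422 · assembly · rank 1 · closed · proved by Summit.MatrixMultiplication.MatrixMultiplication.Theorems.isotypicSaturation_assembly_proof (prover) · by planner
sources: Strassen1988, ChristandlVranaZuiddam2023, Blaser2013
[assembly] PolytopeSaturation → UnitTensorPolytopeMaximal → ω(ℂ) = 2. -/
@[route_item "route-MatrixMultiplication-IsotypicSaturation"]
def Assembly : Prop :=
  PolytopeSaturation → UnitTensorPolytopeMaximal → MatrixMultiplication

-- `Assembly` holds: proved by `Summit.MatrixMultiplication.MatrixMultiplication.Theorems.isotypicSaturation_assembly_proof` (its module imports this route file, so no `_holds` link can be stated here).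

/-! D-0027 §2.1 — DECIDING THEOREM (planner-authored via `route open/edit --closes-file`; by planner-rbadge-MatrixMultiplication-IsotypicSa-7f15d44c-g2-0 2026-08-15T16:25:08Z):
its hypotheses are this route's items and its conclusion the sub-problem Statement (glue_lint), and it elaborates with this file. -/

@[closes "route-MatrixMultiplication-IsotypicSaturation"] theorem closes (hS : PolytopeSaturation) (hU : UnitTensorPolytopeMaximal) : MatrixMultiplication := by
  classical
  -- (1) the two formats compared: `⟨2,2,2⟩ = matMulTensor ℂ 2 2 2` has index types `Fin 2 × Fin 2` (4 elements)
  have h4 : Fintype.card (Fin 2 × Fin 2) ≤ 4 := by simp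
  -- (2) every universal spectral point takes the value `≤ F ⟨4⟩ = 4` at `⟨2,2,2⟩`:
  --     PolytopeSaturation at (s, t) = (⟨2,2,2⟩, ⟨4⟩), whose domination hypothesis is UnitTensorPolytopeMaximal at s
  have hF4 : ∀ F : Literature.Computability.AlgebraicComplexity.SpectralMap ℂ,
      Literature.Computability.AlgebraicComplexity.IsUniversalSpectralPoint ℂ F →
        F (Literature.Computability.AlgebraicComplexity.matMulTensor ℂ 2 2 2) ≤ 4 := by
    intro F hF
    have h1 : F (Literature.Computability.AlgebraicComplexity.matMulTensor ℂ 2 2 2) ≤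
        F (Literature.Computability.AlgebraicComplexity.unitTensor ℂ 4) :=
      hS F hF (Literature.Computability.AlgebraicComplexity.matMulTensor ℂ 2 2 2)
        (Literature.Computability.AlgebraicComplexity.unitTensor ℂ 4)
        (fun n lam hn h => hU h4 h4 h4
          (Literature.Computability.AlgebraicComplexity.matMulTensor ℂ 2 2 2) n lam hn h)
    -- `F ⟨4⟩ = 4`: `F` is a semiring homomorphism on `T(ℂ)` and `[⟨4⟩] = 4`
    have h2 : F (Literature.Computability.AlgebraicComplexity.unitTensor ℂ 4) = 4 := by
      have e := Literature.Computability.AlgebraicComplexity.TensorClass.evalRingHom_mk hF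
        (Literature.Computability.AlgebraicComplexity.unitTensor ℂ 4)
      rw [← Literature.Computability.AlgebraicComplexity.TensorClass.natCast_eq_mk, map_natCast] at e
      exact_mod_cast e.symm
    exact h1.trans_eq h2
  -- (3) Strassen duality (proved in tree): `R̃(⟨2,2,2⟩) ≤ 4`
  have hR : Literature.Computability.AlgebraicComplexity.asymptoticRank
      (Literature.Computability.AlgebraicComplexity.matMulTensor ℂ 2 2 2) ≤ 4 :=
    Literature.Computability.AlgebraicComplexity.strassen_duality_asymptoticRank.asymptoticRank_le
      (Literature.Computability.AlgebraicComplexity.strassen_duality_asymptoticRank_holds ℂ) _ hF4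
  -- (4) `2^ω ≤ R̃(⟨2,2,2⟩)`: termwise, `(2^M)^ω ≤ R(⟨2^M,2^M,2^M⟩) ≤ R(⟨2,2,2⟩^{⊗M})`
  have hpow : (2 : ℝ) ^ Literature.Computability.AlgebraicComplexity.omega ℂ ≤
      Literature.Computability.AlgebraicComplexity.asymptoticRank
        (Literature.Computability.AlgebraicComplexity.matMulTensor ℂ 2 2 2) := by
    unfold Literature.Computability.AlgebraicComplexity.asymptoticRank
    refine le_ciInf fun N => ?_
    -- relabelling `⟨2,2,2⟩^{⊗M} ≅ ⟨2^M,2^M,2^M⟩`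
    have key : Literature.Computability.AlgebraicComplexity.matMulTensor ℂ
        (2 ^ (N + 1)) (2 ^ (N + 1)) (2 ^ (N + 1)) = fun a b c =>
        Literature.Computability.AlgebraicComplexity.kroneckerPow
          (Literature.Computability.AlgebraicComplexity.matMulTensor ℂ 2 2 2) (N + 1)
          (fun i => ((finFunctionFinEquiv.symm a.1) i, (finFunctionFinEquiv.symm a.2) i))
          (fun i => ((finFunctionFinEquiv.symm b.1) i, (finFunctionFinEquiv.symm b.2) i))
          (fun i => ((finFunctionFinEquiv.symm c.1) i, (finFunctionFinEquiv.symm c.2) i)) := by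
      funext a b c
      simp only [Literature.Computability.AlgebraicComplexity.kroneckerPow_apply,
        Literature.Computability.AlgebraicComplexity.matMulTensor]
      by_cases h : a.1 = b.1 ∧ b.2 = c.1 ∧ a.2 = c.2
      · rw [if_pos h]
        obtain ⟨h1, h2, h3⟩ := h
        symm
        refine Finset.prod_eq_one fun i _ => ?_
        rw [if_pos ⟨by rw [h1], by rw [h2], by rw [h3]⟩]
      · rw [if_neg h]
        symm
        have hex : ∃ i, ¬ ((finFunctionFinEquiv.symm a.1) i = (finFunctionFinEquiv.symm b.1) i ∧
            (finFunctionFinEquiv.symm b.2) i = (finFunctionFinEquiv.symm c.1) i ∧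
            (finFunctionFinEquiv.symm a.2) i = (finFunctionFinEquiv.symm c.2) i) := by
          by_contra hall
          push Not at hall
          refine h ⟨?_, ?_, ?_⟩
          · exact finFunctionFinEquiv.symm.injective (funext fun i => (hall i).1)
          · exact finFunctionFinEquiv.symm.injective (funext fun i => (hall i).2.1)
          · exact finFunctionFinEquiv.symm.injective (funext fun i => (hall i).2.2)
        obtain ⟨i, hi⟩ := hex
        exact Finset.prod_eq_zero (Finset.mem_univ i) (if_neg hi)
    have hrel : Literature.Computability.AlgebraicComplexity.tensorRank
        (Literature.Computability.AlgebraicComplexity.matMulTensor ℂ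
          (2 ^ (N + 1)) (2 ^ (N + 1)) (2 ^ (N + 1))) ≤
        Literature.Computability.AlgebraicComplexity.tensorRank
          (Literature.Computability.AlgebraicComplexity.kroneckerPow
            (Literature.Computability.AlgebraicComplexity.matMulTensor ℂ 2 2 2) (N + 1)) := by
      rw [key]
      exact (Literature.Computability.AlgebraicComplexity.tensorRestrictsTo_precomp _ _ _ _).tensorRank_le
    have hn : 2 ≤ 2 ^ (N + 1) := Nat.le_self_pow (Nat.succ_ne_zero N) 2
    have hω := Literature.Computability.AlgebraicComplexity.rpow_omega_le_tensorRank_matMulTensor ℂ hn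
    have hle : (((2 ^ (N + 1) : ℕ)) : ℝ) ^ Literature.Computability.AlgebraicComplexity.omega ℂ ≤
        (Literature.Computability.AlgebraicComplexity.tensorRank
          (Literature.Computability.AlgebraicComplexity.kroneckerPow
            (Literature.Computability.AlgebraicComplexity.matMulTensor ℂ 2 2 2) (N + 1)) : ℝ) :=
      hω.trans (by exact_mod_cast hrel)
    have hz : (0 : ℝ) ≤ ((N : ℝ) + 1)⁻¹ := by positivity
    have hmono := Real.rpow_le_rpow (by positivity) hle hz
    refine le_trans (le_of_eq ?_) hmono
    push_cast
    rw [← Real.rpow_natCast, ← Real.rpow_mul (by norm_num : (0 : ℝ) ≤ 2),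
      ← Real.rpow_mul (by norm_num : (0 : ℝ) ≤ 2)]
    congr 1
    push_cast
    field_simp
  -- (5) `2^ω ≤ 4 = 2^2`, so `ω ≤ 2`; with `2 ≤ ω` (flattening, proved in tree) `ω = 2`
  have h22 : (2 : ℝ) ^ Literature.Computability.AlgebraicComplexity.omega ℂ ≤ (2 : ℝ) ^ (2 : ℝ) := by
    calc (2 : ℝ) ^ Literature.Computability.AlgebraicComplexity.omega ℂ
        ≤ Literature.Computability.AlgebraicComplexity.asymptoticRank
            (Literature.Computability.AlgebraicComplexity.matMulTensor ℂ 2 2 2) := hpow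
      _ ≤ 4 := hR
      _ = (2 : ℝ) ^ (2 : ℝ) := by norm_num
  have hω2 : Literature.Computability.AlgebraicComplexity.omega ℂ ≤ 2 :=
    (Real.rpow_le_rpow_left_iff (by norm_num : (1 : ℝ) < 2)).1 h22
  show Literature.Computability.AlgebraicComplexity.omega ℂ = 2
  exact le_antisymm hω2 (Literature.Computability.AlgebraicComplexity.omega_two_le ℂ)

end Summit.MatrixMultiplication.MatrixMultiplication.Theses.IsotypicSaturation
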